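import Literature.AlgebraicGeometry.Modules.ZeroSchemeUniversal
import Literature.AlgebraicGeometry.Modules.CechBaseChangeHom
import HarnessLib

/-!
# The vanishing locus of a morphism of modules into a vector bundle (the (h6) engine)

Topic `Literature/AlgebraicGeometry/Modules`, namespace `Literature.AlgebraicGeometry.Modules`.  Definitions with bodies
(`vanishingValueIdeal`, `vanishingIdeal`, `vanishingIdealOfLocalizing`) and theorems; no named fact, no instance, no notation,
no `sorry`.

For a morphism `u : 𝓔 ⟶ 𝓥` of `𝒪_X`-modules with `𝓥` finite locally free, the **vanishing locus** of `u` is the closed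
subscheme `V(u) ↪ X` with ideal sheaf the image of `𝓔 ⊗ 𝓥^∨ → 𝒪_X`, `s ⊗ μ ↦ μ(u(s))` (`vanishingIdeal u`, Mathlib
`Scheme.IdealSheafData.ofIdeals` of the ideals of values `vanishingValueIdeal u W = ⟨μ_W(u_W(s))⟩`).  MAIN THEOREM
(**`vanishingIdeal_le_ker_iff`**): for `𝓔` and `𝓥^∨` affine-localizing (e.g. quasi-coherent) and any `g : T ⟶ X`,

  `vanishingIdeal u ≤ ker g^♯  ↔  g^* u = 0`,

i.e. `g` factors through `V(u)` iff the pulled-back morphism `g^*u : g^*𝓔 → g^*𝓥` vanishes (**`exists_comp_subschemeι_eq_iff`**,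
uniquely: `existsUnique_comp_subschemeι_eq_iff`) — «`u = 0` is a CLOSED condition», the elementary engine of the
containment-locus / Weil-restriction statement (h6) of cell `hodgecm-mathlib` (price sheet v0.4 §5b (6), design memo
`H6-DESIGN`): for `X ⊂ ℙ^m_S` flat and `Z ⊂ X` closed, `X_T ⊆ Z_T` iff `T → S` kills `u_n : p_*𝓘_Z(n) → p_*𝒪_X(n)` (`n ≫ 0`,
cohomology and base change), a map from a coherent module to a vector bundle.  The case `𝓔 = 𝒪_X` (one section) is ★
`Modules/ZeroSchemeUniversal`.

* §1 the ideals of values and the ideal sheaf; `vanishingIdeal_ideal` (for `𝓔`, `𝓥^∨` affine-localizing the ideal sheaf IS the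
  ideal of values on every affine — localise numerators as in ★ `sectionValueIdeal_map_basicOpen`);
* §2 `⇐`: `g^*u = 0 ⟹ vanishingIdeal u ≤ ker g^♯` (every value `μ(u s)` dies under `g^♯`: `η_g(u s) = (g^*u)(η_g s) = 0`, ★
  `pullback_map_app_unitSection`, then the frame expansion of ★ `ZeroSchemeUniversal`) — needs only a frame system on `𝓥`;
* §3 `⇒`: `vanishingIdeal u ≤ ker g^♯ ⟹ g^*u = 0` (on affine charts `U ⊆ g⁻¹V` the sections of `g^*𝓔` are `Γ(U) ⊗ Γ(V, 𝓔)`, ★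
  `isBaseChange_unitSectionLE`, and `η_g(u s)` has coordinates `g^♯(λᵢ(u s)) ∈ g^♯(vanishingIdeal) = 0`);
* §4 factorisation through `V(u) ↪ X`, uniqueness, and the subfunctor property.

NOT here (named LACK of (h6)): the vanishing locus of a map into an `S`-FLAT module with PROPER support (purity / Raynaud–Gruson).
HC_CM is proved only modulo the 7 printed citations until rung 0 closes; nothing here is about HC.

## References
* [Fulton1998] W. Fulton, *Intersection Theory*, 2nd ed. (1998), App. B.3.2, B.3.4 (PDF p. 410).
* [Hartshorne1977] R. Hartshorne, *Algebraic Geometry*, GTM 52 (1977), II Prop. 5.9 (PDF p. 146), II Lemma 5.3 (PDF p. 141),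
  II §5 p. 110.
* [MumfordFogartyKirwan1994] D. Mumford, J. Fogarty, F. Kirwan, *GIT*, 3rd ed. (1994), Ch. 6 §3 Prop. 6.16 (p. 126) (the
  identities of a group law cut a closed subscheme).
-/

noncomputable section

-- `TopCat.Presheaf`/`Scheme.Modules` are not reducible (as in Mathlib's `AlgebraicGeometry/Modules`).
set_option backward.isDefEq.respectTransparency false

universe u

open CategoryTheory CategoryTheory.Limits AlgebraicGeometry TopologicalSpace Opposite TensorProduct

namespace Literature.AlgebraicGeometry.Modules

open Literature.AlgebraicGeometry.Motives

variable {X : Scheme.{u}} {E V : X.Modules} (u : E ⟶ V)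

/-! ### §1 The ideals of values and the vanishing ideal sheaf -/

section Ideal

/-- **The ideal of values of `u` over `W`**: the ideal of `Γ(X, W)` generated by the `μ_W(u_W(s))`, `s ∈ Γ(𝓔, W)`,
`μ : 𝓥|_W → 𝒪_X|_W` — the sections over `W` of the image of `𝓔 ⊗ 𝓥^∨ → 𝒪_X`. [cite: Fulton1998, B.3.4 (PDF p. 410)] -/
def vanishingValueIdeal (W : X.Opens) : Ideal Γ(X, W) :=
  Ideal.span (Set.range fun p : Γ(E, W) × (V.over W ⟶ (unitModule X).over W) => (appLE p.2 (𝟙 W) (u.app W p.1) : Γ(X, W)))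

/-- Every value `μ_W(u_W(s))` lies in the ideal of values. [cite: Fulton1998, B.3.4 (PDF p. 410)] -/
theorem appLE_app_mem (W : X.Opens) (s : Γ(E, W)) (μ : V.over W ⟶ (unitModule X).over W) :
    (appLE μ (𝟙 W) (u.app W s) : Γ(X, W)) ∈ vanishingValueIdeal u W :=
  Ideal.subset_span ⟨(s, μ), rfl⟩

/-- Values restrict: `μ_W(u_W(s))|_{W′} = (μ|_{W′})_{W′}(u_{W′}(s|_{W′}))`. [cite: Fulton1998, B.3.4 (PDF p. 410)] -/
theorem map_appLE_app {W W' : X.Opens} (i : W' ⟶ W) (s : Γ(E, W)) (μ : V.over W ⟶ (unitModule X).over W) :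
    X.presheaf.map i.op (appLE μ (𝟙 W) (u.app W s) : Γ(X, W)) =
      appLE (restrictHom i μ) (𝟙 W') (u.app W' (E.presheaf.map i.op s)) := by
  rw [appLE_restrictHom, app_presheaf_map, appLE_congr_hom μ (𝟙 W' ≫ i) (i ≫ 𝟙 W), appLE_map]
  rfl

/-- Values of a functional restrict: `μ_W(w)|_{W′} = (μ|_{W′})_{W′}(w|_{W′})`. [cite: Hartshorne1977, II §5 p. 110] -/
theorem map_appLE_id {W W' : X.Opens} (i : W' ⟶ W) (w : Γ(V, W)) (μ : V.over W ⟶ (unitModule X).over W) :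
    X.presheaf.map i.op (appLE μ (𝟙 W) w : Γ(X, W)) = appLE (restrictHom i μ) (𝟙 W') (V.presheaf.map i.op w) := by
  rw [appLE_restrictHom, appLE_congr_hom μ (𝟙 W' ≫ i) (i ≫ 𝟙 W), appLE_map]
  rfl

/-- The ideal of values over `W` restricts into the ideal of values over `W′ ≤ W`. [cite: Fulton1998, B.3.4 (PDF p. 410)] -/
theorem vanishingValueIdeal_map_le {W W' : X.Opens} (i : W' ⟶ W) :
    (vanishingValueIdeal u W).map (X.presheaf.map i.op).hom ≤ vanishingValueIdeal u W' := by
  rw [vanishingValueIdeal, Ideal.map_span]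
  refine Ideal.span_le.2 ?_
  rintro _ ⟨_, ⟨⟨s, μ⟩, rfl⟩, rfl⟩
  change X.presheaf.map i.op (appLE μ (𝟙 W) (u.app W s)) ∈ _
  rw [map_appLE_app]
  exact appLE_app_mem u W' _ _

/-- **The vanishing ideal sheaf of `u`**: the largest ideal sheaf (Mathlib `Scheme.IdealSheafData.ofIdeals`) whose sections
over every affine open lie in the ideal of values — the image of `𝓔 ⊗ 𝓥^∨ → 𝒪_X` whenever `𝓔` and `𝓥^∨` are
affine-localizing (`vanishingIdeal_ideal`).  Its closed subscheme `(vanishingIdeal u).subscheme ↪ X` is the VANISHING LOCUS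
`V(u)`. [cite: Fulton1998, B.3.4 (PDF p. 410)] [cite: Hartshorne1977, II Prop. 5.9 (PDF p. 146)] -/
def vanishingIdeal : X.IdealSheafData :=
  Scheme.IdealSheafData.ofIdeals fun W => vanishingValueIdeal u W

/-- The sections of the vanishing ideal sheaf over an affine open are values. [cite: Fulton1998, B.3.4 (PDF p. 410)] -/
theorem vanishingIdeal_ideal_le (W : X.affineOpens) : (vanishingIdeal u).ideal W ≤ vanishingValueIdeal u W :=
  Scheme.IdealSheafData.ideal_ofIdeals_le _ W

/-- **Compatibility of the ideals of values with principal opens** when `𝓔` and `𝓥^∨` are affine-localizing (sections over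
`D(f) ⊆ W` are fractions `x|/fⁿ`, Hartshorne II Lemma 5.3): `vanishingValueIdeal u (D(f)) = vanishingValueIdeal u W · Γ(D(f))`.
[cite: Hartshorne1977, II Lemma 5.3 (PDF p. 141)] [cite: Fulton1998, B.3.4 (PDF p. 410)] -/
theorem vanishingValueIdeal_map_basicOpen (hE : IsAffineLocalizing E) (hV : IsAffineLocalizing (dual V))
    (W : X.affineOpens) (f : Γ(X, W)) :
    (vanishingValueIdeal u W).map (X.presheaf.map (homOfLE <| X.basicOpen_le f).op).hom =
      vanishingValueIdeal u (X.basicOpen f) := by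
  refine le_antisymm (vanishingValueIdeal_map_le u (homOfLE (X.basicOpen_le f))) ?_
  rw [vanishingValueIdeal]
  refine Ideal.span_le.2 ?_
  rintro _ ⟨⟨s, μ⟩, rfl⟩
  -- the restriction `f|_{D(f)}` is a unit
  obtain ⟨fW, hfW⟩ : ∃ fW : Γ(X, X.basicOpen f), fW = X.presheaf.map (homOfLE (X.basicOpen_le f)).op f := ⟨_, rfl⟩
  have hu : IsUnit fW := by
    rw [hfW]
    exact X.toRingedSpace.isUnit_res_basicOpen f
  -- numerators: `x|_{D(f)} = f|ⁿ • s`, `μ₀|_{D(f)} = f|^m • μ`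
  obtain ⟨n, x, hx⟩ := hE.numerator W.2 f (W := X.basicOpen f) rfl s
  obtain ⟨m, μ₀, hμ⟩ := hV.numerator W.2 f (W := X.basicOpen f) rfl μ
  have hx' : E.presheaf.map (homOfLE (X.basicOpen_le f)).op x = fW ^ n • s := by rw [hfW]; exact hx
  have hμ' : restrictHom (homOfLE (X.basicOpen_le f)) μ₀ = fW ^ m • μ := by rw [hfW]; exact hμ
  -- evaluate: `(μ₀(u x))|_{D(f)} = f|^m · f|ⁿ · μ(u s)`
  have hval : X.presheaf.map (homOfLE (X.basicOpen_le f)).op (appLE μ₀ (𝟙 _) (u.app _ x) : Γ(X, W)) =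
      fW ^ m * (fW ^ n * (show Γ(X, X.basicOpen f) from appLE μ (𝟙 _) (u.app _ s))) := by
    rw [map_appLE_app, hx', hμ', Scheme.Modules.Hom.app_smul, appLE_smul_id, appLE_smul_right]
    rfl
  have hmem : fW ^ m * (fW ^ n * (show Γ(X, X.basicOpen f) from appLE μ (𝟙 _) (u.app _ s))) ∈
      (vanishingValueIdeal u W).map (X.presheaf.map (homOfLE <| X.basicOpen_le f).op).hom := by
    rw [← hval]
    exact Ideal.mem_map_of_mem _ (appLE_app_mem u W x μ₀)
  exact (Ideal.unit_mul_mem_iff_mem _ (hu.pow n)).1 ((Ideal.unit_mul_mem_iff_mem _ (hu.pow m)).1 hmem)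

/-- The ideals of values as an ideal sheaf, for `𝓔`, `𝓥^∨` affine-localizing (auxiliary; equal to `vanishingIdeal u`,
`vanishingIdeal_eq_ofLocalizing`). [cite: Hartshorne1977, II Prop. 5.9 (PDF p. 146)] -/
def vanishingIdealOfLocalizing (hE : IsAffineLocalizing E) (hV : IsAffineLocalizing (dual V)) : X.IdealSheafData where
  ideal W := vanishingValueIdeal u W
  map_ideal_basicOpen W f := vanishingValueIdeal_map_basicOpen u hE hV W f

/-- For `𝓔`, `𝓥^∨` affine-localizing, the vanishing ideal sheaf IS the ideal sheaf of values.
[cite: Hartshorne1977, II Prop. 5.9 (PDF p. 146)] -/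
theorem vanishingIdeal_eq_ofLocalizing (hE : IsAffineLocalizing E) (hV : IsAffineLocalizing (dual V)) :
    vanishingIdeal u = vanishingIdealOfLocalizing u hE hV :=
  Scheme.IdealSheafData.ofIdeals_ideal (vanishingIdealOfLocalizing u hE hV)

/-- **The image of `𝓔 ⊗ 𝓥^∨ → 𝒪_X` on an affine open**: for `𝓔`, `𝓥^∨` affine-localizing, the sections of `vanishingIdeal u`
over every affine open `W` form exactly the ideal of values `⟨μ_W(u_W(s))⟩`. [cite: Fulton1998, B.3.4 (PDF p. 410)]
[cite: Hartshorne1977, II Prop. 5.9 (PDF p. 146)] -/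
theorem vanishingIdeal_ideal (hE : IsAffineLocalizing E) (hV : IsAffineLocalizing (dual V)) (W : X.affineOpens) :
    (vanishingIdeal u).ideal W = vanishingValueIdeal u W := by
  rw [vanishingIdeal_eq_ofLocalizing u hE hV]
  rfl

end Ideal

/-! ### §2 `g^*u = 0 ⟹ vanishingIdeal u ≤ ker g^♯` -/

section OfZero

variable {T : Scheme.{u}} (g : T ⟶ X)

/-- **A local section of a vector bundle with vanishing pull-back has all its values killed by `g^♯`**: for `w ∈ Γ(𝓥, W)` with
`η_g(w) = 0` and a functional `μ : 𝓥|_W → 𝒪_X|_W`, `g^♯_W(μ_W(w)) = 0` (expand `μ(w) = ∑ᵢ λᵢ(w) μ(bᵢ)` on the frame opens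
`W ∩ U_x`, ★ `appLE_eq_sum_coord`; `g^♯(λᵢ(w|)) = 0` by ★ `unitSection_eq_zero_iff_forall_coord`; glue on `𝒪_T`).
[cite: Fulton1998, B.3.2 (PDF p. 410)] [cite: Hartshorne1977, II §5 p. 110] -/
theorem app_appLE_eq_zero_of_unitSection_eq_zero (F : FrameSystem V) {W : X.Opens} (w : Γ(V, W))
    (hw : unitSection g V W w = 0) (μ : V.over W ⟶ (unitModule X).over W) :
    g.app W (appLE μ (𝟙 W) w : Γ(X, W)) = 0 := by
  classical
  let P : X → X.Opens := fun x => W ⊓ F.U x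
  have hcov : g ⁻¹ᵁ W ≤ ⨆ x, g ⁻¹ᵁ P x := by
    intro y hy
    have hy' : g.base y ∈ (W : Set X) := hy
    exact Opens.mem_iSup.mpr ⟨g.base y, show g.base y ∈ (W ⊓ F.U (g.base y) : X.Opens) from ⟨hy', F.mem _⟩⟩
  refine TopCat.Sheaf.eq_of_locally_eq' (T.sheaf : TopCat.Sheaf CommRingCat T) (fun x => g ⁻¹ᵁ P x) (g ⁻¹ᵁ W)
    (fun x => homOfLE (g.preimage_mono inf_le_left)) hcov _ _ fun x => ?_
  rw [map_zero]
  change T.presheaf.map (homOfLE (g.preimage_mono (inf_le_left : P x ≤ W))).op (g.app W (appLE μ (𝟙 W) w)) = 0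
  haveI : Fintype (F.I x) := Fintype.ofEquiv _ (F.enum x).symm
  let e := SheafOfModules.restrictTrivialisation (R := X.ringCatSheaf) (homOfLE (inf_le_right : P x ≤ F.U x)) (F.frame x)
  rw [← app_map_eq_map_app g (homOfLE (inf_le_left : P x ≤ W)), map_appLE_id,
    appLE_eq_sum_coord e (restrictHom (homOfLE (inf_le_left : P x ≤ W)) μ) (𝟙 (P x)), map_sum]
  refine Finset.sum_eq_zero fun i _ => ?_
  rw [show coord e (𝟙 (P x)) (V.presheaf.map (homOfLE (inf_le_left : P x ≤ W)).op w) i •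
      appLE (restrictHom (homOfLE (inf_le_left : P x ≤ W)) μ) (𝟙 (P x)) (V.presheaf.map (𝟙 (P x)).op (basisSection e i)) =
      coord e (𝟙 (P x)) (V.presheaf.map (homOfLE (inf_le_left : P x ≤ W)).op w) i *
      (show Γ(X, P x) from
        appLE (restrictHom (homOfLE (inf_le_left : P x ≤ W)) μ) (𝟙 (P x)) (V.presheaf.map (𝟙 (P x)).op (basisSection e i)))
      from rfl, map_mul]
  -- `g^♯(λᵢ(w|_{P x})) = 0` from `η_g(w) = 0`
  have hη : unitSection g V (P x) (V.presheaf.map (homOfLE (inf_le_left : P x ≤ W)).op w) = 0 := by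
    rw [unitSection_map, hw, map_zero]
  have hc := (unitSection_eq_zero_iff_forall_coord g e (V.presheaf.map (homOfLE (inf_le_left : P x ≤ W)).op w)).mp hη i
  rw [hc, zero_mul]

/-- **`g^*u = 0 ⟹ vanishingIdeal u ≤ ker g^♯`** (for `𝓥` with a frame system; no hypothesis on `𝓔` or `𝓥^∨`): the sections of
`vanishingIdeal u` over an affine `W` are values `μ(u s)` (`vanishingIdeal_ideal_le`), and `η_g(u s) = (g^*u)(η_g s) = 0` (★
`pullback_map_app_unitSection`), so `g^♯` kills them (`app_appLE_eq_zero_of_unitSection_eq_zero`). [cite: Fulton1998, B.3.4 (PDF p. 410)]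
[cite: Hartshorne1977, II Prop. 5.9 (PDF p. 146)] -/
theorem vanishingIdeal_le_ker_of_pullback_map_eq_zero (F : FrameSystem V) (h : (Scheme.Modules.pullback g).map u = 0) :
    vanishingIdeal u ≤ g.ker := by
  refine (Scheme.IdealSheafData.le_ofIdeals_iff).2 fun W => ?_
  refine (vanishingIdeal_ideal_le u W).trans ?_
  rw [vanishingValueIdeal]
  refine Ideal.span_le.2 ?_
  rintro _ ⟨⟨s, μ⟩, rfl⟩
  refine app_appLE_eq_zero_of_unitSection_eq_zero g F (u.app W s) ?_ μ
  rw [← pullback_map_app_unitSection g u W s, h, Scheme.Modules.Hom.zero_app]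
  rfl

end OfZero

/-! ### §3 `vanishingIdeal u ≤ ker g^♯ ⟹ g^*u = 0` -/

section ToZero

variable {T : Scheme.{u}} (g : T ⟶ X)

/-- **`η_g(u_W(s)) = 0` on an affine `W` inside a frame open** when `vanishingIdeal u ≤ ker g^♯` (and `𝓔`, `𝓥^∨` are
affine-localizing): the coordinates `λᵢ(u s)` of `u s` in a frame `e` of `𝓥|_W` are values `λᵢ(u s) = (λᵢ)_W(u_W(s))`, hence in
`vanishingIdeal u (W)` (`vanishingIdeal_ideal`) `≤ ker g^♯_W`, and ★ `unitSection_eq_zero_iff_forall_coord`.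
[cite: Fulton1998, B.3.2 and B.3.4 (PDF p. 410)] -/
theorem unitSection_app_eq_zero_of_vanishingIdeal_le_ker (hE : IsAffineLocalizing E) (hV : IsAffineLocalizing (dual V))
    (h : vanishingIdeal u ≤ g.ker) (W : X.affineOpens) {I : Type u} [Fintype I]
    (e : SheafOfModules.free I ≅ V.over (W : X.Opens)) (s : Γ(E, (W : X.Opens))) :
    unitSection g V W (u.app W s) = 0 := by
  rw [unitSection_eq_zero_iff_forall_coord g e]
  intro i
  have hmem : (coord e (𝟙 (W : X.Opens)) (u.app W s) i : Γ(X, W)) ∈ (vanishingIdeal u).ideal W := by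
    rw [vanishingIdeal_ideal u hE hV W, coord_def]
    exact appLE_app_mem u W s (dualBasis e i)
  exact (Scheme.IdealSheafData.le_ofIdeals_iff.1 h) W hmem

/-- **`(g^*u)(σ) = 0` for every section `σ` of `g^*𝓔` over an affine chart `U ⊆ g⁻¹W`** (`W` affine inside a frame open of
`𝓥`), when `vanishingIdeal u ≤ ker g^♯`: `Γ(U, g^*𝓔) = Γ(U) ⊗_{Γ(W)} Γ(W, 𝓔)` (★ `isBaseChange_unitSectionLE`), and on the
generators `a · η_g(s)|_U` the value is `a · η_g(u s)|_U = 0` (`unitSection_app_eq_zero_of_vanishingIdeal_le_ker`).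
[cite: Hartshorne1977, II §5 p. 110] [cite: Fulton1998, B.3.4 (PDF p. 410)] -/
theorem pullback_map_app_eq_zero_of_chart (hE : IsAffineLocalizing E) (hV : IsAffineLocalizing (dual V))
    (h : vanishingIdeal u ≤ g.ker) (W : X.affineOpens) {I : Type u} [Fintype I]
    (e : SheafOfModules.free I ≅ V.over (W : X.Opens)) (U : T.affineOpens) (i : (U : T.Opens) ≤ g ⁻¹ᵁ (W : X.Opens))
    (σ : Γ((Scheme.Modules.pullback g).obj E, (U : T.Opens))) :
    ((Scheme.Modules.pullback g).map u).app U σ = 0 := by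
  letI := (g.appLE W U i).hom.toAlgebra
  letI : Module Γ(X, W) Γ((Scheme.Modules.pullback g).obj E, (U : T.Opens)) := Module.compHom _ (g.appLE W U i).hom
  haveI : IsScalarTower Γ(X, W) Γ(T, U) Γ((Scheme.Modules.pullback g).obj E, (U : T.Opens)) :=
    ⟨fun a b x => mul_smul ((g.appLE W U i).hom a) b x⟩
  have hj := isBaseChange_unitSectionLE g E i W.2 U.2 hE
  obtain ⟨y, rfl⟩ := hj.equiv.surjective σ
  induction y using TensorProduct.induction_on with
  | zero => simp
  | add y z hy hz => rw [map_add, map_add, hy, hz, add_zero]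
  | tmul a s =>
      rw [IsBaseChange.equiv_tmul, Scheme.Modules.Hom.app_smul, unitSectionLEₗ_apply, unitSectionLE, app_presheaf_map,
        pullback_map_app_unitSection g u W s, unitSection_app_eq_zero_of_vanishingIdeal_le_ker u g hE hV h W e s, map_zero,
        smul_zero]

/-- **`vanishingIdeal u ≤ ker g^♯ ⟹ g^*u = 0`** (for `𝓥` with a frame system and `𝓔`, `𝓥^∨` affine-localizing): a section of
`g^*𝓥` vanishes iff it vanishes on the affine charts `U ⊆ g⁻¹W`, `W` affine inside a frame open (sheaf locality), where
`pullback_map_app_eq_zero_of_chart` applies. [cite: Fulton1998, B.3.4 (PDF p. 410)] [cite: Hartshorne1977, II Prop. 5.9 (PDF p. 146)] -/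
theorem pullback_map_eq_zero_of_vanishingIdeal_le_ker (F : FrameSystem V) (hE : IsAffineLocalizing E)
    (hV : IsAffineLocalizing (dual V)) (h : vanishingIdeal u ≤ g.ker) : (Scheme.Modules.pullback g).map u = 0 := by
  classical
  apply Scheme.Modules.hom_ext
  intro U'
  ext σ
  rw [Scheme.Modules.Hom.zero_app]
  change ((Scheme.Modules.pullback g).map u).app U' σ = 0
  -- the cover of `U'` by affine charts `U ⊆ U' ∩ g⁻¹W`, `W ⊆ U_x` affine
  let ι : Type u := {q : X × X.affineOpens × T.affineOpens //
    (q.2.1 : X.Opens) ≤ F.U q.1 ∧ (q.2.2 : T.Opens) ≤ U' ⊓ g ⁻¹ᵁ (q.2.1 : X.Opens)}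
  have hcov : U' ≤ ⨆ q : ι, (q.1.2.2 : T.Opens) := by
    intro y hy
    obtain ⟨_, ⟨W, hW, rfl⟩, hyW, hWU⟩ :=
      X.isBasis_affineOpens.exists_subset_of_mem_open (F.mem (g.base y)) (F.U (g.base y)).2
    have hy2 : y ∈ (U' ⊓ g ⁻¹ᵁ W : T.Opens) := ⟨hy, hyW⟩
    obtain ⟨_, ⟨U, hU, rfl⟩, hyU, hUU⟩ := T.isBasis_affineOpens.exists_subset_of_mem_open hy2 (U' ⊓ g ⁻¹ᵁ W).2
    exact Opens.mem_iSup.mpr ⟨⟨(g.base y, ⟨W, hW⟩, ⟨U, hU⟩), hWU, hUU⟩, hyU⟩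
  refine TopCat.Sheaf.eq_of_locally_eq'
    (⟨((Scheme.Modules.pullback g).obj V).presheaf, ((Scheme.Modules.pullback g).obj V).isSheaf⟩ : TopCat.Sheaf Ab T)
    (fun q : ι => (q.1.2.2 : T.Opens)) U' (fun q => homOfLE (q.2.2.trans inf_le_left)) hcov _ _ fun q => ?_
  obtain ⟨⟨x, W, U⟩, hWU, hUU⟩ := q
  rw [map_zero]
  change ((Scheme.Modules.pullback g).obj V).presheaf.map (homOfLE (hUU.trans inf_le_left)).op
    (((Scheme.Modules.pullback g).map u).app U' σ) = 0
  haveI : Fintype (F.I x) := Fintype.ofEquiv _ (F.enum x).symm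
  rw [← app_presheaf_map]
  exact pullback_map_app_eq_zero_of_chart u g hE hV h W
    (SheafOfModules.restrictTrivialisation (R := X.ringCatSheaf) (homOfLE hWU) (F.frame x)) U (hUU.trans inf_le_right) _

/-- **THE VANISHING LOCUS OF A MORPHISM INTO A VECTOR BUNDLE, ideal form**: for `u : 𝓔 ⟶ 𝓥` with `𝓥` finite locally free
(a frame system), `𝓔` and `𝓥^∨` affine-localizing, and any `g : T ⟶ X`: `vanishingIdeal u ≤ ker g^♯ ↔ g^*u = 0`.
[cite: Fulton1998, B.3.2 and B.3.4 (PDF p. 410)] [cite: Hartshorne1977, II Prop. 5.9 (PDF p. 146)]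
[cite: MumfordFogartyKirwan1994, Ch. 6 §3 Prop. 6.16 (p. 126)] -/
theorem vanishingIdeal_le_ker_iff (F : FrameSystem V) (hE : IsAffineLocalizing E) (hV : IsAffineLocalizing (dual V)) :
    vanishingIdeal u ≤ g.ker ↔ (Scheme.Modules.pullback g).map u = 0 :=
  ⟨pullback_map_eq_zero_of_vanishingIdeal_le_ker u g F hE hV, vanishingIdeal_le_ker_of_pullback_map_eq_zero u g F⟩

end ToZero

/-! ### §4 Factorisation through the vanishing locus `V(u) ↪ X` -/

section Factor

variable {T : Scheme.{u}} (g : T ⟶ X)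

/-- **`g : T ⟶ X` factors through the vanishing locus `V(u)` iff `g^*u = 0`** (Mathlib: factorisation through the closed
subscheme of an ideal sheaf `𝓙` iff `𝓙 ≤ ker g^♯` — `Scheme.Hom.toImage`, `IdealSheafData.inclusion`, `Scheme.Hom.le_ker_comp`).
[cite: Hartshorne1977, II Prop. 5.9 (PDF p. 146)] [cite: MumfordFogartyKirwan1994, Ch. 6 §3 Prop. 6.16 (p. 126)] -/
theorem exists_comp_subschemeι_eq_iff (F : FrameSystem V) (hE : IsAffineLocalizing E) (hV : IsAffineLocalizing (dual V)) :
    (∃ g' : T ⟶ (vanishingIdeal u).subscheme, g' ≫ (vanishingIdeal u).subschemeι = g) ↔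
      (Scheme.Modules.pullback g).map u = 0 := by
  rw [← vanishingIdeal_le_ker_iff u g F hE hV]
  constructor
  · rintro ⟨g', rfl⟩
    exact (Scheme.IdealSheafData.ker_subschemeι (vanishingIdeal u)).ge.trans (g'.le_ker_comp _)
  · intro h
    refine ⟨g.toImage ≫ Scheme.IdealSheafData.inclusion h, ?_⟩
    rw [Category.assoc, Scheme.IdealSheafData.inclusion_subschemeι]
    exact g.toImage_imageι

/-- **Unique factorisation**: `V(u) ↪ X` is a closed immersion, hence mono — `V(u)` REPRESENTS the subfunctor
`T ↦ {g : T ⟶ X | g^*u = 0}`. [cite: Hartshorne1977, II Prop. 5.9 (PDF p. 146)] [cite: MumfordFogartyKirwan1994, Ch. 6 §3 Prop. 6.16 (p. 126)] -/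
theorem existsUnique_comp_subschemeι_eq_iff (F : FrameSystem V) (hE : IsAffineLocalizing E) (hV : IsAffineLocalizing (dual V)) :
    (∃! g' : T ⟶ (vanishingIdeal u).subscheme, g' ≫ (vanishingIdeal u).subschemeι = g) ↔
      (Scheme.Modules.pullback g).map u = 0 := by
  rw [← exists_comp_subschemeι_eq_iff u g F hE hV]
  refine ⟨fun h => h.exists, fun ⟨g', hg'⟩ => ⟨g', hg', fun g'' hg'' => ?_⟩⟩
  exact (cancel_mono (vanishingIdeal u).subschemeι).mp (hg''.trans hg'.symm)

/-- **`u` dies on its vanishing locus**: `ι^*u = 0` for `ι : V(u) ↪ X`. [cite: Fulton1998, B.3.2 (PDF p. 410)] -/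
theorem pullback_subschemeι_map_eq_zero (F : FrameSystem V) (hE : IsAffineLocalizing E) (hV : IsAffineLocalizing (dual V)) :
    (Scheme.Modules.pullback (vanishingIdeal u).subschemeι).map u = 0 :=
  (exists_comp_subschemeι_eq_iff u (vanishingIdeal u).subschemeι F hE hV).mp ⟨𝟙 _, Category.id_comp _⟩

/-- **The vanishing locus is a subfunctor**: if `g^*u = 0` then `(h ≫ g)^*u = 0` (no hypothesis: `(h ≫ g)^* ≅ h^* ∘ g^*`, Mathlib
`Scheme.Modules.pullbackComp`, and `h^* 0 = 0`). [cite: Hartshorne1977, II §5 p. 110] -/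
theorem pullback_comp_map_eq_zero {T' : Scheme.{u}} (h : T' ⟶ T) (hu : (Scheme.Modules.pullback g).map u = 0) :
    (Scheme.Modules.pullback (h ≫ g)).map u = 0 := by
  have nat := (Scheme.Modules.pullbackComp h g).hom.naturality u
  rw [Functor.comp_map, hu, Functor.map_zero, zero_comp] at nat
  rw [← cancel_epi ((Scheme.Modules.pullbackComp h g).hom.app E), comp_zero, ← nat]

end Factor

end Literature.AlgebraicGeometry.Modules

end
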